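import Summits.ABC.StewartYu.GenThreeVanishingPoints
import HarnessLib

/-!
# Gen-3 engines ⇒ the zero estimate, III: the orbit count `Card((Σ_X · G*)/G*) = #Σ_X = 2X + 1`
# (Nesterenko 2003, Lemma 5.2 — from multiplicative independence alone, no `|Λ|`)

`Summits/ABC/StewartYu/GenThreeVanishingOrbit.lean` — cell `abc-stewartyu` (rung F-A1 = Stewart–Yu 2001,
route `PadicPrimesKummerThird`, cruxes `Y07Odd` stmt-ABC-19658 / `Y07Two` stmt-ABC-19659), seat p3 (g4).
Theorems only; companion of `GenThreeVanishing.lean` / `GenThreeVanishingPoints.lean` (deliverable V7 of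
the V/E interface sheet `plan/m3/ZE-INTERFACE.md`).

After the zero estimate `Nesterenko2003_prop51` has produced the obstruction subgroup
`H = 𝔙 × T_Φ ⊂ G = 𝔾ₐ × 𝔾ₘ^m` of dimension `≤ m` (so `H.addDim + (m − r) ≤ m`, `r = rank Φ`,
`Φ` generated by the rows of `M`), its inequality carries the factor `Card((Σ_X · H)/H)` =
`Set.ncard (QuotientGroup.mk '' Σ_X)`.  For the points `Σ_X = {θ^x : |x| ≤ X}`, `θ = (c, ξ)` with `c ≠ 0`
and `ξ₁, …, ξₘ` MULTIPLICATIVELY INDEPENDENT, distinct points of `Σ_X` are incongruent mod `H`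
(Nesterenko 2003, Lemma 5.2, p. 91: `Σ ∩ G* = {e}` — here WITHOUT the archimedean clause (5.9)–(5.10),
which print needs only because its `ξⱼ = αⱼ^{1/N}` may be dependent up to roots of unity; for
independent `ξ` the congruence `θ^d ∈ H` forces `d = 0`: if `𝔙 = 0` the `𝔾ₐ`-coordinate `d·c` vanishes,
and if `𝔙 = ℂ` then `r ≥ 1` and `ξ^{d·M₀} = 1` for the nonzero row `M₀`), so
`Set.ncard (mk '' Σ_X) = #Σ_X = 2X + 1` (`ncard_image_mk_zpowSet`).

References: Yu. V. Nesterenko, *Linear forms in logarithms of rational numbers*, LNM 1819 (2003),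
§5.2, Lemma 5.2 (pp. 91–92).
-/

noncomputable section

open Finset
open Literature.NumberTheory.Transcendental
open Literature.NumberTheory.Transcendental.GaGm

namespace Summit.ABC.StewartYu.GenThreeVanishing

section Orbit

variable {m : ℕ}

/-- `x ↦ θ^x` is injective on `ℤ` when the `𝔾ₐ`-coordinate `c` of `θ = (c, ξ)` is nonzero
(the `𝔾ₐ`-coordinate of `θ^x` is `x·c`). [folklore] -/
theorem zpow_injective_of_ne_zero (c : ℂ) (hc : c ≠ 0) (ξ : Fin m → ℂˣ) :
    Function.Injective fun x : ℤ => ((Multiplicative.ofAdd c, ξ) : GaGm m) ^ x := by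
  intro x x' h
  have h1 := congrArg (fun g : GaGm m => coord g 0) h
  simp only [coord_zpow_zero] at h1
  have h2 : ((x : ℂ) - x') * c = 0 := by rw [sub_mul, h1, sub_self]
  rcases mul_eq_zero.mp h2 with h3 | h3
  · exact_mod_cast sub_eq_zero.mp h3
  · exact absurd h3 hc

/-- `#Σ_X = 2X + 1` for `Σ_X = {θ^x : |x| ≤ X}`, `θ = (c, ξ)`, `c ≠ 0`. [folklore] -/
theorem ncard_zpowSet (c : ℂ) (hc : c ≠ 0) (ξ : Fin m → ℂˣ) (X : ℕ) :
    Set.ncard {g : GaGm m | ∃ x : ℤ, |x| ≤ (X : ℤ) ∧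
        g = ((Multiplicative.ofAdd c, ξ) : GaGm m) ^ x} = 2 * X + 1 := by
  classical
  have hset : {g : GaGm m | ∃ x : ℤ, |x| ≤ (X : ℤ) ∧ g = ((Multiplicative.ofAdd c, ξ) : GaGm m) ^ x} =
      (fun x : ℤ => ((Multiplicative.ofAdd c, ξ) : GaGm m) ^ x) '' ((Finset.Icc (-(X : ℤ)) X : Finset ℤ) : Set ℤ) := by
    ext g
    simp only [Set.mem_setOf_eq, Set.mem_image, Finset.coe_Icc, Set.mem_Icc, abs_le]
    constructor
    · rintro ⟨x, hx, rfl⟩; exact ⟨x, hx, rfl⟩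
    · rintro ⟨x, hx, rfl⟩; exact ⟨x, hx, rfl⟩
  rw [hset, Set.ncard_image_of_injective _ (zpow_injective_of_ne_zero c hc ξ), Set.ncard_coe_finset,
    Int.card_Icc]
  omega

/-- **Lemma 5.2 without `|Λ|`**: for `θ = (c, ξ)`, `c ≠ 0`, `ξ` multiplicatively independent, and a
connected algebraic subgroup `H = 𝔙 × T_Φ` of dimension `≤ m` (`Φ` generated by the independent rows
of `M`), `θ^d ∈ H` forces `d = 0`. [cite: Nesterenko2003, Lemma 5.2] -/
theorem zpow_mem_toSubgroup_iff (c : ℂ) (hc : c ≠ 0) (ξ : Fin m → ℂˣ)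
    (hind : ∀ φ : Fin m → ℤ, ∏ j, ξ j ^ φ j = 1 → φ = 0)
    (H : ConnAlgSubgroup m) (r : ℕ) (M : Matrix (Fin r) (Fin m) ℤ)
    (hM : LinearIndependent ℤ (fun i => M i))
    (hchars : H.chars = AddSubgroup.closure (Set.range fun i => M i))
    (hdim : H.addDim + (m - r) ≤ m) (d : ℤ) :
    ((Multiplicative.ofAdd c, ξ) : GaGm m) ^ d ∈ H.toSubgroup ↔ d = 0 := by
  constructor
  · rintro ⟨h1, h2⟩
    cases hadd : H.addPart
    · -- `𝔙 = 0`: the `𝔾ₐ`-coordinate `d·c` of `θ^d` is `0`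
      have h3 : (((Multiplicative.ofAdd c, ξ) : GaGm m) ^ d).1 = 1 := h1 hadd
      have h4 : coord (((Multiplicative.ofAdd c, ξ) : GaGm m) ^ d) 0 = 0 := by
        rw [coord_zero, h3]; rfl
      rw [coord_zpow_zero] at h4
      rcases mul_eq_zero.mp h4 with h5 | h5
      · exact_mod_cast h5
      · exact absurd h5 hc
    · -- `𝔙 = ℂ`: then `r ≥ 1`, and the nonzero row `M 0` kills `ξ^d`
      have hr : 0 < r := by
        have : H.addDim = 1 := by simp [ConnAlgSubgroup.addDim, hadd]
        omega
      set i₀ : Fin r := ⟨0, hr⟩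
      have hMi : M i₀ ≠ 0 := hM.ne_zero i₀
      have hmem : M i₀ ∈ H.chars := by
        rw [hchars]; exact AddSubgroup.subset_closure ⟨i₀, rfl⟩
      have h3 : ∏ j, ((((Multiplicative.ofAdd c, ξ) : GaGm m) ^ d).2 j) ^ (M i₀ j) = 1 := h2 _ hmem
      have h4 : ∏ j, ξ j ^ (d * M i₀ j) = 1 := by
        rw [← h3]
        refine Finset.prod_congr rfl fun j _ => ?_
        rw [zpow_mul]; rfl
      have h5 := hind (fun j => d * M i₀ j) h4
      by_contra hd
      apply hMi
      funext j
      have := congrFun h5 j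
      simp only [Pi.zero_apply, mul_eq_zero] at this
      exact this.resolve_left hd
  · rintro rfl
    rw [zpow_zero]; exact H.toSubgroup.one_mem

/-- **V7 — the orbit count `Card((Σ_X · H)/H) = 2X + 1`** (Nesterenko 2003, Lemma 5.2 without `|Λ|`):
for `θ = (c, ξ)` with `c ≠ 0`, `ξ` multiplicatively independent, and the obstruction subgroup `H` of
`Nesterenko2003_prop51` (rows of `M` independent, `H.chars` = their closure, `H.addDim + (m − r) ≤ m`),
the points of `Σ_X = {θ^x : |x| ≤ X}` are pairwise incongruent mod `H`. [cite: Nesterenko2003, Lemma 5.2] -/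
theorem ncard_image_mk_zpowSet (c : ℂ) (hc : c ≠ 0) (ξ : Fin m → ℂˣ)
    (hind : ∀ φ : Fin m → ℤ, ∏ j, ξ j ^ φ j = 1 → φ = 0)
    (H : ConnAlgSubgroup m) (r : ℕ) (M : Matrix (Fin r) (Fin m) ℤ)
    (hM : LinearIndependent ℤ (fun i => M i))
    (hchars : H.chars = AddSubgroup.closure (Set.range fun i => M i))
    (hdim : H.addDim + (m - r) ≤ m) (X : ℕ) :
    Set.ncard ((QuotientGroup.mk : GaGm m → GaGm m ⧸ H.toSubgroup) ''
        {g : GaGm m | ∃ x : ℤ, |x| ≤ (X : ℤ) ∧ g = ((Multiplicative.ofAdd c, ξ) : GaGm m) ^ x}) =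
      2 * X + 1 := by
  rw [← ncard_zpowSet c hc ξ X]
  refine Set.InjOn.ncard_image ?_
  rintro g ⟨x, hx, rfl⟩ g' ⟨x', hx', rfl⟩ h
  have h1 : (((Multiplicative.ofAdd c, ξ) : GaGm m) ^ x)⁻¹ * ((Multiplicative.ofAdd c, ξ) : GaGm m) ^ x' ∈
      H.toSubgroup := QuotientGroup.eq.mp h
  rw [← zpow_neg, ← zpow_add] at h1
  have h2 := (zpow_mem_toSubgroup_iff c hc ξ hind H r M hM hchars hdim (-x + x')).mp h1
  have h3 : x = x' := by omega
  rw [h3]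

end Orbit

end Summit.ABC.StewartYu.GenThreeVanishing

end
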